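import Mathlib
import Literature.NumberTheory.LFunctions.CharZeroSum
import HarnessLib

/-!
# Thorner–Zaman 2024, §3–§4: the explicit zero-DETECTION inequality for Dirichlet `L`-functions
# (Theorem 4.2) and its kernel, the Kolesnik–Straus form of Turán's second main theorem (Lemma 4.3)

Topic `Literature/NumberTheory/LFunctions` (namespace `Literature.NumberTheory.LFunctions`, the
paper's objects in the existing sub-namespace `ThornerZaman2024` of
`ExplicitLogFreeZeroDensityDirichlet.lean`, which types Theorem 1.2 / Corollary 6.1 of the same paper
and is NOT re-typed here). STATEMENT LAYER (D-0014): two NAMED FACTS (status theorem-in-print) —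
Lemma 4.3 (Kolesnik–Straus 1983, as restated) and Theorem 4.2 — over honest definitions of the §3
"notation, conventions" block (`𝓛`, `𝒩_η`, `M_η`, `V`, `A₀`, `N_η`, `N_η*`), of Hypothesis 4.1 and of
the detecting Dirichlet polynomial `Σ_{N_η < p ≤ u} χ(p) log p / p^{1+iτ}`. Zero vocabulary = the
tree's `ExplicitPsiChar.charNontrivialZeros` (CITED). Typed for the Landau–Siegel programme (rung
F-S3, §C harvest row T-029, tag `detector`; §B-det START-HERE): an explicit power-sum DETECTOR — "if
`L(s,χ)` has a zero within `η` of `1 + iτ`, then a mean square of a prime sum over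
`(N_η, N_η*]` is `≥` an explicit positive quantity" — in the regime `Re s ≈ 1`; what transfers to a
detector near `Re s = ½` is the kernel (Lemma 4.3), not the constants. Nothing here bears on
exceptional zeros beyond what is printed.

## What the source prints (held text `paper:arxiv-2208.11123`, corpus-tex chunks p0011–p0012,
## read 2026-08-26)

J. Thorner, A. Zaman, *An explicit version of Bombieri's log-free density estimate and Sárközy's
theorem for shifted primes*, Forum Math. **36** (2024) 1059–1080 = arXiv:2208.11123
[ThornerZaman2024LogFree].

**§3 "Notation, conventions, and the key optimization"** (p0011:L3–45), verbatim list: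
"(i) `T ≥ 1`, `Q ≥ 1`, `1 ≤ q ≤ Q`; (ii) `𝓛 = log(QT)`; (iii) `τ ∈ ℝ` with `|τ| ≤ T`;
(iv) `α = 7.931 643 766 252 22…` (decimal expansion of a number whose origin is explained below);
(v) `A = 3.907 668 327 378 39…` (idem); (vi) `R = √(A²+1)`; (vii) `χ (mod q)` a primitive Dirichlet
character; (viii) `1/(3A𝓛) ≤ η ≤ 1/(10A)`; (ix) `s₀ = 1 + η + iτ`; (x) `max{Q,T} > 10⁴`; (xi) `δ_χ` the
indicator function of the trivial primitive character; (xii) if `δ_χ = 1`, then `3 × 10¹² ≤ |τ| ≤ T`;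
(xiv) `𝒩_η = Aη(1+10⁻⁷)⁻¹((2/3)𝓛 + 13.04) + 9`; (xv) `M_η = (α−1)𝒩_η`, which is at least `63.9`;
(xvi) `k ∈ [M_η, M_η + 𝒩_η − 1] ∩ ℤ`; (xvii) `V = 2(4eα)^{1/(α−1)} + 0.38 = 4.184 416 849…`;
(xviii) `A₀ = 1/(eV) = 0.087 916 537 56…`; (xix) `A₁ > 2` satisfies `V⁻¹ = A₁ e^{1 − A₁(α−1)/(2α)}`, so
`A₁ = 11.065 510 190…`; (xx) `N_η = exp(A₀ M_η/η)`; (xxi) `N_η* = exp(A₁ M_η/η)`; (xxii) `ξ = 1 + 10⁻⁷`."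
"Our values of `α` and `A` arise as the values that minimize `(4eα 2^{α−1})^A` with the constraints
`α > 1`, `A > 1`, and `4eα (2/√(A²+1))^{α−1} = 2/3` (3.1)."

> **Hypothesis 4.1** (p0012:L5–8). Recall the notation and conventions in §3. There exists a
> nontrivial zero `ρ₀` of `L(s,χ)` such that `|1 + iτ − ρ₀| ≤ η`.

> **Theorem 4.2** (p0012:L11–18). Recall the notation and conventions in §3. If Hypothesis 4.1 is
> true, then `1 ≤ (η³/200) M_η e^{2.672 32 M_η} ∫_{N_η}^{N_η*} |Σ_{N_η < p ≤ u} χ(p) log p / p^{1+iτ}|² du/u`.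
> **Remark.** We remind the reader that if `χ = 1`, then one must have `3 × 10¹² ≤ |τ| ≤ T` per (xii);
> otherwise, Hypothesis 4.1 is false by [RH verification]. If `χ ≠ 1`, then one must have
> `max{q,T} > 10⁴` per (x); otherwise, Hypothesis 4.1 is false by [Platt].

> **Lemma 4.3** ([KolesnikStraus]) (p0012:L22–28). Let `M ≥ 0` and `N ≥ 1` be integers, and let
> `z₁, …, z_N ∈ ℂ` [the held tex prints `\Z`; the companion paper of the same authors,
> arXiv:2108.10878 p.12, prints the same lemma with `z₁,…,z_N ∈ ℂ`, as the application to
> `z_j = (s₀ − ρ)⁻¹` requires]. There exists an integer `k ∈ [M+1, M+N]` such that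
> `|z₁^k + ⋯ + z_N^k| ≥ 1.007 (1/(4e(1 + M/N)))^N |z₁|^k`.
> **Remark.** The constant `4e` is essentially optimal; see [Makai].

## Lean rendering / design choices

* CONSTANTS. The §3 quantities are honest real functions of the three numerical constants
  `(α, A, A₁)` and of `(η, 𝓛)`: `calN`, `calM`, `bigV`, `aZero`, `nLow = N_η`, `nHigh = N_η*`. The
  numbers `α`, `A` are DEFINED in print only as "the minimizers of (3.1)" with their decimal
  expansions, and `A₁` implicitly by (xix); a typed fact must not pretend to more. Theorem 4.2 is
  therefore typed in the form print supports exactly: THERE EXIST reals `α, A, A₁` lying in the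
  printed decimal brackets (`α ∈ [7.931643766, 7.931643767]`, `A ∈ [3.907668327, 3.907668328]`,
  `A₁ ∈ [11.06551019, 11.0655102]`), satisfying the printed defining relations ((3.1)'s constraint,
  (xix) with `A₁ > 2`), for which the detection inequality holds throughout the printed ranges
  (i)–(iii), (vii)–(viii), (x), (xii). This is implied by the printed theorem (instantiate with the
  paper's `α, A, A₁`) and carries every digit print gives; it asserts nothing for other constants.
  The minimisation property itself is recorded in prose only (no downstream use).
* ZEROS / HYPOTHESIS 4.1. "Nontrivial zero of `L(s,χ)`" = an element of the tree's
  `ExplicitPsiChar.charNontrivialZeros χ` (`L(ρ,χ) = 0`, `0 < Re ρ < 1`); `hypothesis41 χ τ η`.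
* DETECTOR. `detectorSum χ τ N u = Σ_{p prime, N < p ≤ u} χ(p) log p · p^{−(1+iτ)}` (finite sum over
  `p ≤ ⌊u⌋`); the weight `du/u` integral over `[N_η, N_η*]` is Mathlib's interval integral
  (`detectorIntegral`). The constant `2.672 32` and the `200` are the printed rationals.
* LEMMA 4.3 is typed over `z : Fin N → ℂ` with an arbitrary distinguished index `j₀` in the role of
  `z₁` (the printed statement has no maximality hypothesis on `z₁`; the labelling is free), `M N : ℕ`,
  `1 ≤ N`; cited to Kolesnik–Straus 1983 AND to the restatement read.
* No instances, no notation; imports `CharZeroSum` + Mathlib.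

## Deliberately not here

Theorem 1.2 / Corollary 6.1 (typed: `thornerZaman2024_theorem12`, `_corollary61`); §2 (explicit
zero-free region / Page / Deuring–Heilbronn for the family, Lemma 2.4–Thm 2.15: a §B-dh seat's file);
§§4.1–5 (the proof: (4.1)–(4.4), the pre-sifted large sieve); Lemma 4.3's sharpness [Makai]; the
minimisation (3.1) as a Lean statement.

References: [cite: ThornerZaman2024LogFree, §3 (i)–(xxii), (3.1); §4 Hypothesis 4.1, Theorem 4.2,
Lemma 4.3]; [cite: KolesnikStraus1983, main theorem (as restated in ThornerZaman2024LogFree Lemma 4.3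
and Thorner–Zaman arXiv:2108.10878 p. 12)].

«The programme SEARCHES and TYPES; no claim about Landau–Siegel zeros, Theorems 1–2 of
arXiv:2211.02515 or a repaired Margin232 until a kernel theorem says so.»
-/

noncomputable section

open scoped Classical
open Complex Finset MeasureTheory

namespace Literature.NumberTheory.LFunctions

namespace ThornerZaman2024

/-! ### §3: the constants block as functions of `(α, A, A₁, η, 𝓛)` -/

/-- (ii) `𝓛 = log(QT)`. [cite: ThornerZaman2024LogFree, §3 (ii)] -/
def scriptL (Q T : ℝ) : ℝ :=
  Real.log (Q * T)

/-- (xiv) `𝒩_η = A η (1 + 10⁻⁷)⁻¹ ((2/3) 𝓛 + 13.04) + 9`.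
[cite: ThornerZaman2024LogFree, §3 (xiv)] -/
def calN (A η L : ℝ) : ℝ :=
  A * η * (1 + (10 : ℝ)⁻¹ ^ 7)⁻¹ * (2 / 3 * L + 13.04) + 9

/-- (xv) `M_η = (α − 1) 𝒩_η`. [cite: ThornerZaman2024LogFree, §3 (xv)] -/
def calM (α A η L : ℝ) : ℝ :=
  (α - 1) * calN A η L

/-- (xvii) `V = 2 (4eα)^{1/(α−1)} + 0.38` (`= 4.184 416 849…` for the printed `α`).
[cite: ThornerZaman2024LogFree, §3 (xvii)] -/
def bigV (α : ℝ) : ℝ :=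
  2 * (4 * Real.exp 1 * α) ^ (1 / (α - 1)) + 0.38

/-- (xviii) `A₀ = 1/(eV)` (`= 0.087 916 537 56…`). [cite: ThornerZaman2024LogFree, §3 (xviii)] -/
def aZero (α : ℝ) : ℝ :=
  1 / (Real.exp 1 * bigV α)

/-- (xx) `N_η = exp(A₀ M_η / η)`. [cite: ThornerZaman2024LogFree, §3 (xx)] -/
def nLow (α A η L : ℝ) : ℝ :=
  Real.exp (aZero α * calM α A η L / η)

/-- (xxi) `N_η* = exp(A₁ M_η / η)`. [cite: ThornerZaman2024LogFree, §3 (xxi)] -/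
def nHigh (α A A₁ η L : ℝ) : ℝ :=
  Real.exp (A₁ * calM α A η L / η)

/-- The printed identification of the constants: `α`, `A` lie in the printed decimal brackets and
satisfy the constraint of (3.1), `4eα (2/√(A²+1))^{α−1} = 2/3`; `A₁ > 2` satisfies (xix)
`V⁻¹ = A₁ e^{1 − A₁(α−1)/(2α)}` and lies in its printed bracket.
[cite: ThornerZaman2024LogFree, §3 (iv), (v), (xix), (3.1)] -/
def IsPrintedConstants (α A A₁ : ℝ) : Prop :=
  (7.931643766 ≤ α ∧ α ≤ 7.931643767) ∧ (3.907668327 ≤ A ∧ A ≤ 3.907668328) ∧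
    (11.06551019 ≤ A₁ ∧ A₁ ≤ 11.0655102) ∧
      4 * Real.exp 1 * α * (2 / Real.sqrt (A ^ 2 + 1)) ^ (α - 1) = 2 / 3 ∧
        2 < A₁ ∧ (bigV α)⁻¹ = A₁ * Real.exp (1 - A₁ * (α - 1) / (2 * α))

/-! ### §4: Hypothesis 4.1, the detecting prime sum, Theorem 4.2 -/

section OneCharacter

variable {q : ℕ} [NeZero q]

/-- **Hypothesis 4.1**: "There exists a nontrivial zero `ρ₀` of `L(s,χ)` such that
`|1 + iτ − ρ₀| ≤ η`" (nontrivial zero = the tree's `charNontrivialZeros χ`: `L(ρ₀,χ) = 0`,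
`0 < Re ρ₀ < 1`). ("We believe that Hypothesis 4.1 is false. Indeed, it contradicts GRH.")
[cite: ThornerZaman2024LogFree, Hypothesis 4.1] -/
def hypothesis41 (χ : DirichletCharacter ℂ q) (τ η : ℝ) : Prop :=
  ∃ ρ₀ ∈ ExplicitPsiChar.charNontrivialZeros χ, ‖(1 : ℂ) + (τ : ℂ) * I - ρ₀‖ ≤ η

/-- The detecting prime sum of Theorem 4.2: `Σ_{N < p ≤ u} χ(p) log p / p^{1+iτ}` (`p` prime).
[cite: ThornerZaman2024LogFree, Theorem 4.2] -/
def detectorSum (χ : DirichletCharacter ℂ q) (τ N u : ℝ) : ℂ :=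
  ∑ p ∈ (Finset.Icc (1 : ℕ) ⌊u⌋₊).filter (fun p : ℕ => p.Prime ∧ N < (p : ℝ)),
    χ (p : ZMod q) * ((Real.log p : ℝ) : ℂ) / (p : ℂ) ^ ((1 : ℂ) + (τ : ℂ) * I)

/-- The weighted mean square `∫_{N}^{N*} |Σ_{N < p ≤ u} χ(p) log p / p^{1+iτ}|² du/u` of Theorem 4.2.
[cite: ThornerZaman2024LogFree, Theorem 4.2] -/
def detectorIntegral (χ : DirichletCharacter ℂ q) (τ N Nstar : ℝ) : ℝ :=
  ∫ u in N..Nstar, ‖detectorSum χ τ N u‖ ^ 2 / u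

end OneCharacter

/-! ### Lemma 4.3: Turán's second main theorem in the form of Kolesnik–Straus -/

/-- **Lemma 4.3 = Kolesnik–Straus 1983** (as restated by Thorner–Zaman). Let `M ≥ 0` and `N ≥ 1` be
integers and `z₁, …, z_N ∈ ℂ`. There exists an integer `k ∈ [M+1, M+N]` such that
`|z₁^k + ⋯ + z_N^k| ≥ 1.007 · (1/(4e(1 + M/N)))^N · |z₁|^k`. The labelling is free: the inequality is
asserted with ANY chosen `z_{j₀}` in the role of `z₁` (typed over `z : Fin N → ℂ` with a distinguished
index `j₀`). "The constant `4e` is essentially optimal" [Makai]. Status: theorem-in-print (named fact).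
[cite: KolesnikStraus1983, main theorem] [cite: ThornerZaman2024LogFree, Lemma 4.3] -/
def lemma43_kolesnikStraus : Prop :=
  ∀ (M N : ℕ), 1 ≤ N → ∀ (z : Fin N → ℂ) (j₀ : Fin N),
    ∃ k : ℕ, M + 1 ≤ k ∧ k ≤ M + N ∧
      1.007 * (1 / (4 * Real.exp 1 * (1 + (M : ℝ) / N))) ^ N * ‖z j₀‖ ^ k ≤
        ‖∑ j : Fin N, z j ^ k‖

/-- **Thorner–Zaman 2024, Theorem 4.2** (the explicit zero-detection inequality). With the printed
constants `α = 7.931643766…`, `A = 3.907668327…`, `A₁ = 11.06551019…` of §3 (here: some `α, A, A₁`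
in the printed decimal brackets satisfying the printed defining relations — `IsPrintedConstants`),
and with `𝓛 = log(QT)`, `𝒩_η`, `M_η = (α−1)𝒩_η`, `N_η = exp(A₀M_η/η)`, `N_η* = exp(A₁M_η/η)` as in §3:
for all `T ≥ 1`, `Q ≥ 1`, `1 ≤ q ≤ Q`, `χ (mod q)` primitive, `|τ| ≤ T`, `1/(3A𝓛) ≤ η ≤ 1/(10A)`,
`max{Q,T} > 10⁴`, and `3 × 10¹² ≤ |τ|` when `χ` is the trivial primitive character (`q = 1`): if
`L(s,χ)` has a nontrivial zero `ρ₀` with `|1 + iτ − ρ₀| ≤ η` (Hypothesis 4.1), then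
`1 ≤ (η³/200) · M_η · e^{2.67232 M_η} · ∫_{N_η}^{N_η*} |Σ_{N_η < p ≤ u} χ(p) log p / p^{1+iτ}|² du/u`.
Status: theorem-in-print (named fact, not proved here).
[cite: ThornerZaman2024LogFree, Theorem 4.2 (with §3 (i)–(xxi) and Hypothesis 4.1)] -/
def thornerZaman2024_theorem42 : Prop :=
  ∃ α A A₁ : ℝ, IsPrintedConstants α A A₁ ∧
    ∀ (Q T : ℝ) (q : ℕ) (hq : NeZero q) (χ : DirichletCharacter ℂ q) (τ η : ℝ),
      1 ≤ T → 1 ≤ Q → 1 ≤ q → (q : ℝ) ≤ Q → χ.IsPrimitive → |τ| ≤ T →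
        1 / (3 * A * scriptL Q T) ≤ η → η ≤ 1 / (10 * A) → 10 ^ 4 < max Q T →
          (q = 1 → 3 * 10 ^ 12 ≤ |τ|) →
            hypothesis41 χ τ η →
              1 ≤ η ^ 3 / 200 * calM α A η (scriptL Q T) *
                  Real.exp (2.67232 * calM α A η (scriptL Q T)) *
                    detectorIntegral χ τ (nLow α A η (scriptL Q T))
                      (nHigh α A A₁ η (scriptL Q T))

/-! ### Bookkeeping (proved) -/

/-- The admissible `η`-window (viii) is nonempty exactly when `𝓛 ≥ 10/3`; in the printed regime
`max{Q,T} > 10⁴` (with `Q, T ≥ 1`) one has `𝓛 = log(QT) > log 10⁴ > 9`, so it is.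
Here: `1/(3A𝓛) ≤ 1/(10A)` for `A > 0` and `𝓛 ≥ 10/3`. [cite: ThornerZaman2024LogFree, §3 (viii), (x)] -/
theorem eta_window_nonempty {A L : ℝ} (hA : 0 < A) (hL : 10 / 3 ≤ L) :
    1 / (3 * A * L) ≤ 1 / (10 * A) := by
  have h1 : 0 < 10 * A := by positivity
  have h2 : 10 * A ≤ 3 * A * L := by nlinarith
  exact one_div_le_one_div_of_le h1 h2

/-- `N_η ≤ N_η*` as soon as `A₀ ≤ A₁` and `M_η/η ≥ 0` (for the printed constants `A₀ ≈ 0.088 < 2 < A₁`),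
so the integral of Theorem 4.2 is over a genuine interval.
[cite: ThornerZaman2024LogFree, §3 (xviii)–(xxi)] -/
theorem nLow_le_nHigh {α A A₁ η L : ℝ} (h : aZero α ≤ A₁) (hM : 0 ≤ calM α A η L / η) :
    nLow α A η L ≤ nHigh α A A₁ η L := by
  unfold nLow nHigh
  apply Real.exp_le_exp.mpr
  rw [mul_div_assoc, mul_div_assoc]
  exact mul_le_mul_of_nonneg_right h hM

end ThornerZaman2024

end Literature.NumberTheory.LFunctions

end
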